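import Summits.HodgeConjecture.CorCM.DecicWeil23PairFamilyHodgeOfMarkman
import Literature.AlgebraicGeometry.ComplexMultiplication.CMAbelianVarietyRealisedHolds
import HarnessLib

/-!
# COR-CM — ONE CM fivefold `B` of `k`-signature `(2,3)` over a decic CM field with `A₅/S₅` quintic part: the Hodge conjecture
# for every product of copies `E^a × B^n`, GIVEN ONLY Markman's hyperbolic-sixfold theorem

Cell `pub-hodgecm2` (COR-CM), seat b30 gen 22 (2026-08-22); count-neutral own lane DECIC-WEIL-23PAIR.  Theorems only; no
definition, no named fact, no `sorry`.  HONEST FRAMING: CONDITIONAL on the single displayed named fact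
`HodgeTheory.Markman2025_weilClasses_algebraic_hyperbolicSixfold` (E. Markman, arXiv:2502.03415, Thm 1.5.1 — UNREFEREED);
`HC_CM` is not asserted and no case of the Hodge conjecture is claimed unconditionally.

THE POINT.  The two-type theorem `DecicWeil23Pair.hodgeConjectureFor_biproduct_comp_vec_of_markmanD` (products of copies of
`E, B₁, B₂` for two DISTINCT `(2,3)`-types) contains the ONE-type case `E^a × B^n` — take for `B₂` ANY realisation
(Shimura's existence theorem `ComplexMultiplication.exists_isCMTypeRealisation`, a theorem of the tree) of ANY second
`(2,3)`-type `Φ' ≠ Φ` (there are ten `2`-subsets of the five pairs: `exists_cmType_ne₂₃`) and a slot map avoiding the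
third slot.  So: for EVERY CM abelian fivefold `B ⊨ (K; Φ)` of `k`-signature `(2,3)` over a decic CM field `K ⊇ i(k)` on
whose five embeddings over `τ` `Aut(ℂ/k)` is `3`-transitive (quintic part `A₅` or `S₅`), and the CM elliptic curve `E` of
`k`: HC for all `E^a × B^n` (any order of the factors) and everything they dominate, GIVEN ONLY Markman's sixfold theorem.
Seat b09's `CorCM/DecicCurveFivefoldHodgeOfMarkman{,Cyclic}` is the Galois-CYCLIC decic case (half-circle type); this file
is the generic (`A₅/S₅`) case, where the exact census has the same shape (pairs and the Weil weight of the sixfold `B × E`).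

* §1 `exists_cmType_ne₂₃` — another `(2,3)`-type;
* §2 **`hodgeConjectureFor_biproduct_comp_vec₂_of_markmanD`** — HC for `⨁_j ![E, B] (κ j)`, every `κ : Fin N → Fin 2`;
  `hodgeConjectureFor_of_avDominatedBy_comp_vec₂_of_markmanD`;
* §3 `hodgeConjectureFor_of_avDominatedBy_family₁_of_markmanD` — the family form for ONE type (all `A_j ⊨ (K; Φ)`, e.g. the
  Galois conjugates `σB` of the same type, any CM structures), `× E^a`, everything dominated.
[cite: Markman2025SecantWeil, Thm 1.5.1] [cite: Shimura1998, §6.2 Thm. 3; §6.1 Thm. 2 Cor.] [cite: Pohlmann1968, Thm 1]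
[cite: MumfordAV1970, §19]

## References
* [Markman2025SecantWeil] E. Markman, arXiv:2502.03415 (unrefereed), Thm 1.5.1.  [Shimura1998] G. Shimura, *Abelian
  Varieties with Complex Multiplication and Modular Functions*, §6.1 Thm. 2 Cor., §6.2 Thm. 3.  [Pohlmann1968] Ann. of
  Math. 88, Thm 1.  [MumfordAV1970] §19.
-/

noncomputable section

open CategoryTheory CategoryTheory.Limits NumberField

namespace Summit.HodgeConjecture.CorCM.DecicWeil23Pair

open Literature.AlgebraicGeometry Literature.AlgebraicGeometry.Motives Literature.AlgebraicGeometry.HodgeTheory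
open Literature.AlgebraicGeometry.ComplexMultiplication (IsCMTypeRealisation exists_isCMTypeRealisation)
open Literature.AlgebraicTopology.SingularHomology
open Summit.HodgeConjecture.CorCM.Domination (AVDominatedBy)
open Summit.HodgeConjecture.CorCM.AndreRiemann (sumFam avDominatedBy_prod_of_biproduct avDominatedBy_biproduct_reindex)

open scoped Classical

/-! ## §1 A second `(2,3)`-type -/

section Aux

variable {K : Type} [Field K] [NumberField K] [IsCMField K] {k : Type} [Field k] [NumberField k] [IsCMField k]

omit [IsCMField K] [IsCMField k] in
/-- **Another `(2,3)`-type.**  For every CM type `Φ` of the decic `K ⊇ i(k)` some CM type `Φ' ≠ Φ` has exactly two members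
over `τ`: in a frame `e : Hom(K, ℂ) ≃ Fin 5 × Bool` (`exists_frame₅`) `Φ` reads `{a | e⁻¹(a, ⊤) ∈ Φ} = J`; take a
`2`-subset `J' ≠ J` of `Fin 5` and `Φ' = {s | (e s).2 = [(e s).1 ∈ J']}`. [folklore] -/
theorem exists_cmType_ne₂₃ (h10 : Module.finrank ℚ K = 10) (h2 : Module.finrank ℚ k = 2) (i : k →+* K) {τ : k →+* ℂ}
    (hττ : ComplexEmbedding.conjugate τ ≠ τ) (hk : ∀ σ : k →+* ℂ, σ = τ ∨ σ = ComplexEmbedding.conjugate τ)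
    (Φ : CMType K) :
    ∃ Φ' : CMType K, (Finset.univ.filter fun s : K →+* ℂ => s.comp i = τ ∧ s ∈ Φ'.1).card = 2 ∧ Φ ≠ Φ' := by
  obtain ⟨e, he_sign, he_conj⟩ := exists_frame₅ h10 h2 i hττ hk
  -- the positions of `Φ`
  set J : Finset (Fin 5) := Finset.univ.filter fun a => e.symm (a, true) ∈ Φ.1 with hJ
  -- a different `2`-subset
  obtain ⟨J', hJ'card, hJ'ne⟩ : ∃ J' : Finset (Fin 5), J'.card = 2 ∧ J' ≠ J := by
    have key : ∀ J₀ : Finset (Fin 5), ∃ J' : Finset (Fin 5), J'.card = 2 ∧ J' ≠ J₀ := by decide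
    exact key J
  -- its reading type
  let P : Fin 5 → Bool := fun a => decide (a ∈ J')
  have hax : ∀ s : K →+* ℂ, s ∈ ({s | (e s).2 = P (e s).1} : Set (K →+* ℂ)) ↔
      ComplexEmbedding.conjugate s ∉ ({s | (e s).2 = P (e s).1} : Set (K →+* ℂ)) := by
    intro s
    simp only [Set.mem_setOf_eq, he_conj]
    cases (e s).2 <;> cases P (e s).1 <;> simp
  refine ⟨⟨{s | (e s).2 = P (e s).1}, hax⟩, ?_, fun hΦ => hJ'ne ?_⟩
  · -- two members over `τ`
    rw [← card_filter_symm_true₅ he_sign (fun s => s ∈ ({s | (e s).2 = P (e s).1} : Set (K →+* ℂ))), ← hJ'card]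
    congr 1
    ext a
    simp only [Finset.mem_filter, Finset.mem_univ, true_and, Set.mem_setOf_eq, Equiv.apply_symm_apply, P]
    simp
  · -- `Φ' = Φ` would force `J' = J`
    ext a
    have hmem : a ∈ J ↔ e.symm (a, true) ∈ Φ.1 := by rw [hJ, Finset.mem_filter]; simp
    rw [hmem, hΦ]
    change a ∈ J' ↔ (e (e.symm (a, true))).2 = P (e (e.symm (a, true))).1
    rw [Equiv.apply_symm_apply]
    simp [P]

end Aux

/-! ## §2 One `(2,3)`-type: `E^a × B^n` -/

section Main

variable {K : Type} [Field K] [NumberField K] [IsCMField K] {k : Type} [Field k] [NumberField k] [IsCMField k] {N : ℕ}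
  {Φ : CMType K} {B : AbelianVariety ℂ} {ι : 𝓞 K →+* End B} {θ : K →+* Module.End ℂ (complexBetti B.X 1)}
  {Ψ : CMType k} {E : AbelianVariety ℂ} {ιE : 𝓞 k →+* End E} {θE : k →+* Module.End ℂ (complexBetti E.X 1)}

/-- **THE HODGE CONJECTURE FOR EVERY PRODUCT OF COPIES `E^a × B^n` OF ONE CM FIVEFOLD OF `k`-SIGNATURE `(2,3)` AND THE CM
CURVE OF `k`, GIVEN ONLY Markman's hyperbolic-sixfold theorem.**  `K ⊇ i(k)` ANY CM field of degree `10` over the imaginary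
quadratic `k` such that `Aut(ℂ)` permutes the five embeddings of `K` over `τ` `3`-TRANSITIVELY (`h3T`; e.g. `K = K⁺k` with
`Gal((K⁺)ᶜ/ℚ) = A₅` or `S₅`), `B ⊨ (K; Φ)` a CM abelian fivefold with exactly two members of `Φ` over `τ`, `E ⊨ (k; Ψ ∋ τ)`:
for every `κ : Fin N → Fin 2`, every rational `(q,q)`-class on `⨁_j ![E, B] (κ j)` is algebraic.  Proof: a second
`(2,3)`-type `Φ' ≠ Φ` (`exists_cmType_ne₂₃`, ten `2`-subsets of five pairs) is realised by some `B'` (Shimura, `exists_isCMTypeRealisation`);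
`⨁_j ![E, B] (κ j)` is factorwise `⨁_j ![E, B, B'] (κ j)` (slots `0, 1` only), to which the two-type theorem
`hodgeConjectureFor_of_avDominatedBy_comp_vec_of_markmanD` applies.
[cite: Markman2025SecantWeil, Thm 1.5.1] [cite: Shimura1998, §6.2 Thm. 3] [cite: Pohlmann1968, Thm 1] [cite: MumfordAV1970, §19] -/
theorem hodgeConjectureFor_biproduct_comp_vec₂_of_markmanD
    (hM6 : Markman2025_weilClasses_algebraic_hyperbolicSixfold)
    (h10 : Module.finrank ℚ K = 10) (h2 : Module.finrank ℚ k = 2) (i : k →+* K)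
    (hB : IsCMTypeRealisation Φ B ι θ) (hE : IsCMTypeRealisation Ψ E ιE θE) {τ : k →+* ℂ} (hτΨ : τ ∈ Ψ.1)
    (h23 : (Finset.univ.filter fun s : K →+* ℂ => s.comp i = τ ∧ s ∈ Φ.1).card = 2)
    (h3T : ∀ x y : Fin 3 ↪ {s : K →+* ℂ // s.comp i = τ}, ∃ ρ : ℂ ≃+* ℂ, ∀ j : Fin 3, (ρ : ℂ →+* ℂ).comp (x j).1 = (y j).1)
    (κ : Fin N → Fin 2) :
    HodgeConjectureFor (⨁ fun j => (![E, B] : Fin 2 → AbelianVariety ℂ) (κ j)).dim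
      (⨁ fun j => (![E, B] : Fin 2 → AbelianVariety ℂ) (κ j)).X := by
  have hττ : ComplexEmbedding.conjugate τ ≠ τ := QuarticCM.conjugate_ne τ
  have hk : ∀ σ : k →+* ℂ, σ = τ ∨ σ = ComplexEmbedding.conjugate τ := fun σ =>
    QuarticCM.eq_or_eq_conjugate_of_quadratic h2 τ σ
  obtain ⟨Φ', h23', hne⟩ := exists_cmType_ne₂₃ h10 h2 i hττ hk Φ
  obtain ⟨B', ι', θ', hB'⟩ := exists_isCMTypeRealisation Φ'
  -- slots `0, 1` of `(E, B, B')` are `(E, B)`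
  have hslot : ∀ x : Fin 2, (![E, B, B'] : Fin 3 → AbelianVariety ℂ) (Fin.castSucc x) =
      (![E, B] : Fin 2 → AbelianVariety ℂ) x := by
    intro x
    fin_cases x <;> rfl
  have hdom : AVDominatedBy (⨁ fun j => (![E, B] : Fin 2 → AbelianVariety ℂ) (κ j))
      (⨁ fun j => (![E, B, B'] : Fin 3 → AbelianVariety ℂ) ((Fin.castSucc ∘ κ) j)) :=
    AVDominatedBy.biproduct_map fun j => by
      rw [Function.comp_apply, hslot]
      exact AVDominatedBy.refl _
  exact hodgeConjectureFor_of_avDominatedBy_comp_vec_of_markmanD hM6 h10 h2 i hB hB' hE hτΨ h23 h23' hne h3T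
    (Fin.castSucc ∘ κ) hdom

/-- **Everything dominated by a product of copies of `E, B`** (abelian subvarieties, quotients, isogenous varieties) satisfies
the Hodge conjecture, GIVEN ONLY Markman's sixfold theorem. [cite: Markman2025SecantWeil, Thm 1.5.1] [cite: MumfordAV1970, §19] -/
theorem hodgeConjectureFor_of_avDominatedBy_comp_vec₂_of_markmanD
    (hM6 : Markman2025_weilClasses_algebraic_hyperbolicSixfold)
    (h10 : Module.finrank ℚ K = 10) (h2 : Module.finrank ℚ k = 2) (i : k →+* K)
    (hB : IsCMTypeRealisation Φ B ι θ) (hE : IsCMTypeRealisation Ψ E ιE θE) {τ : k →+* ℂ} (hτΨ : τ ∈ Ψ.1)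
    (h23 : (Finset.univ.filter fun s : K →+* ℂ => s.comp i = τ ∧ s ∈ Φ.1).card = 2)
    (h3T : ∀ x y : Fin 3 ↪ {s : K →+* ℂ // s.comp i = τ}, ∃ ρ : ℂ ≃+* ℂ, ∀ j : Fin 3, (ρ : ℂ →+* ℂ).comp (x j).1 = (y j).1)
    (κ : Fin N → Fin 2) {C : AbelianVariety ℂ}
    (hC : AVDominatedBy C (⨁ fun j => (![E, B] : Fin 2 → AbelianVariety ℂ) (κ j))) :
    HodgeConjectureFor C.dim C.X :=
  Domination.hodgeConjectureFor_of_avDominatedBy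
    (hodgeConjectureFor_biproduct_comp_vec₂_of_markmanD hM6 h10 h2 i hB hE hτΨ h23 h3T κ) hC

end Main

/-! ## §3 The family form for ONE type -/

section Family

variable {K : Type} [Field K] [NumberField K] [IsCMField K] {k : Type} [Field k] [NumberField k] [IsCMField k]
  {n : ℕ} {Φ : Fin n → CMType K} {A : Fin n → AbelianVariety ℂ} {ι : ∀ j, 𝓞 K →+* End (A j)}
  {θ : ∀ j, K →+* Module.End ℂ (complexBetti (A j).X 1)}
  {Ψ : CMType k} {E : AbelianVariety ℂ} {ιE : 𝓞 k →+* End E} {θE : k →+* Module.End ℂ (complexBetti E.X 1)}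

/-- **THE FAMILY FORM, ONE TYPE.**  `A_j ⊨ (K; Φ_j)` (`j < n`) CM abelian fivefolds all of the SAME type `Φ_j = Φ_{j₁}` of
`k`-signature `(2,3)` (e.g. the Galois conjugates `σB` of one CM fivefold sharing its type, with any CM structures and
polarisations), `K ⊇ i(k)` decic with `Aut(ℂ)` `3`-transitive over `τ`, `E ⊨ (k; Ψ ∋ τ)`: every `C` dominated by
`E^a × ⨁_j A_j` satisfies the Hodge conjecture, GIVEN ONLY Markman's sixfold theorem (each `A_j` is dominated by `A_{j₁}`,
Shimura §6.1 Thm. 2 Cor., `avDominatedBy_of_cmType_eq`). [cite: Markman2025SecantWeil, Thm 1.5.1]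
[cite: Shimura1998, §6.1 Thm. 2 Cor.] [cite: MumfordAV1970, §19] -/
theorem hodgeConjectureFor_of_avDominatedBy_family₁_of_markmanD
    (hM6 : Markman2025_weilClasses_algebraic_hyperbolicSixfold)
    (h10 : Module.finrank ℚ K = 10) (h2 : Module.finrank ℚ k = 2) (i : k →+* K)
    (hA : ∀ j, IsCMTypeRealisation (Φ j) (A j) (ι j) (θ j)) {τ : k →+* ℂ} (j₁ : Fin n)
    (h23 : (Finset.univ.filter fun s : K →+* ℂ => s.comp i = τ ∧ s ∈ (Φ j₁).1).card = 2) (hpos : ∀ j, Φ j = Φ j₁)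
    (h3T : ∀ x y : Fin 3 ↪ {s : K →+* ℂ // s.comp i = τ}, ∃ ρ : ℂ ≃+* ℂ, ∀ l : Fin 3, (ρ : ℂ →+* ℂ).comp (x l).1 = (y l).1)
    (hE : IsCMTypeRealisation Ψ E ιE θE) (hτΨ : τ ∈ Ψ.1) (a : ℕ)
    {C : AbelianVariety ℂ} (hC : AVDominatedBy C ((⨁ fun _ : Fin a => E).prod (⨁ A))) :
    HodgeConjectureFor C.dim C.X := by
  -- each `A_j` is dominated by `A_{j₁}`
  have hdomB : ∀ j, AVDominatedBy (A j) (A j₁) := fun j => avDominatedBy_of_cmType_eq (hpos j) (hA j) (hA j₁)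
  -- domination of `E^a × ⨁ A` by a product of copies of `E, A j₁`
  let Y : Fin 2 → AbelianVariety ℂ := ![E, A j₁]
  have h₁ : AVDominatedBy (⨁ fun _ : Fin a => E) (⨁ fun _ : Fin a => Y 0) :=
    AVDominatedBy.biproduct_map fun _ => AVDominatedBy.refl E
  have h₂ : AVDominatedBy (⨁ A) (⨁ fun _ : Fin n => Y 1) :=
    AVDominatedBy.biproduct_map fun j => hdomB j
  have h₁₂' := avDominatedBy_prod_of_biproduct h₁ h₂
  let κ' : Fin a ⊕ Fin n → Fin 2 := Sum.elim (fun _ => 0) fun _ => 1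
  have hfam : sumFam (fun _ : Fin a => Y 0) (fun _ : Fin n => Y 1) = Y ∘ κ' := funext fun x => by
    cases x <;> rfl
  rw [hfam] at h₁₂'
  have hdom := avDominatedBy_biproduct_reindex finSumFinEquiv.symm h₁₂'
  exact Domination.hodgeConjectureFor_of_avDominatedBy
    (hodgeConjectureFor_biproduct_comp_vec₂_of_markmanD hM6 h10 h2 i (hA j₁) hE hτΨ h23 h3T (κ' ∘ finSumFinEquiv.symm))
    (hC.trans hdom)

/-- **In particular: the Hodge conjecture for `∏_j A_j` itself** — every product of members of ONE `(2,3)`-isogeny class over a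
decic CM field with `A₅/S₅` quintic part (e.g. `B^n`), GIVEN ONLY Markman's sixfold theorem.
[cite: Markman2025SecantWeil, Thm 1.5.1] [cite: MumfordAV1970, §19] -/
theorem hodgeConjectureFor_biproduct_family₁_of_markmanD
    (hM6 : Markman2025_weilClasses_algebraic_hyperbolicSixfold)
    (h10 : Module.finrank ℚ K = 10) (h2 : Module.finrank ℚ k = 2) (i : k →+* K)
    (hA : ∀ j, IsCMTypeRealisation (Φ j) (A j) (ι j) (θ j)) {τ : k →+* ℂ} (j₁ : Fin n)
    (h23 : (Finset.univ.filter fun s : K →+* ℂ => s.comp i = τ ∧ s ∈ (Φ j₁).1).card = 2) (hpos : ∀ j, Φ j = Φ j₁)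
    (h3T : ∀ x y : Fin 3 ↪ {s : K →+* ℂ // s.comp i = τ}, ∃ ρ : ℂ ≃+* ℂ, ∀ l : Fin 3, (ρ : ℂ →+* ℂ).comp (x l).1 = (y l).1)
    (hE : IsCMTypeRealisation Ψ E ιE θE) (hτΨ : τ ∈ Ψ.1) :
    HodgeConjectureFor (⨁ A).dim (⨁ A).X :=
  hodgeConjectureFor_of_avDominatedBy_family₁_of_markmanD hM6 h10 h2 i hA j₁ h23 hpos h3T hE hτΨ 0
    (C := ⨁ A) ⟨AbelianVariety.prodLift 0 (𝟙 _), AbelianVariety.snd _ _, 1, one_ne_zero, by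
      rw [AbelianVariety.prodLift_snd, one_smul]⟩

end Family

end Summit.HodgeConjecture.CorCM.DecicWeil23Pair

end
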